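import Literature.Computability.Complexity.RothvossUBadPart
import HarnessLib

/-!
# The contribution of `M`-bad pairs (Rothvoss 2017, Lemma 15)

This file has four parts: **Part I** — intertwiners of fixed-point-free involutions (the
combinatorial input replacing "randomly partition `B̃ᵢ = Cᵢ ∪ Dᵢ`" in the proof of Lemma 15);
**Part II** — the big-block swap `bigSwap j θ` (re-choosing the core remainder among the big
blocks) and its invariances; **Part III** — the block-product structure of `ext₀` (the paper's
`X = X₁ × ⋯ × X_{2m+1}`); **Part IV** — Lemma 15 (per encoding, and summed over encodings).

# Part I — Intertwiners of fixed-point-free involutions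

Two fixed-point-free involutions on finite sets of the same size are conjugate (as permutations they
have the same cycle type, `Equiv.Perm.isConj_iff_cycleType_eq`), and the set of intertwiners
`{θ : θ ∘ φ = ψ ∘ θ}` is a torsor under the centraliser of `φ`; hence its size does not depend on `ψ`
(`card_intertwiners_eq`). In Part IV this makes the family of big-block swaps compatible with a fixed
template matching `f₀` a *uniform* cover.

## References

* T. Rothvoss, *The matching polytope has exponential extension complexity*, J. ACM 64(6) (2017)
  41:1–41:19, §3.6.2 (Lemma 15) [Rothvoss2017].
-/

namespace Literature.Computability.Complexity

open Finset

namespace Rothvoss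

open scoped Classical

/-- A fixed-point-free involution, as a permutation, has cycle type `(2, 2, …, 2)` (`|α|/2` entries).
[folklore] -/
theorem cycleType_of_fpf_invol {α : Type*} [Fintype α] [DecidableEq α] (σ : Equiv.Perm α)
    (h : ∀ v, σ v ≠ v ∧ σ (σ v) = v) :
    σ.cycleType = Multiset.replicate (Fintype.card α / 2) 2 := by
  have h2 : σ ^ 2 = 1 := by
    ext v
    simp [sq, (h v).2]
  have hct := Equiv.Perm.cycleType_of_pow_prime_eq_one h2
  have hsupp : σ.support = univ := by
    ext v
    simp [Equiv.Perm.mem_support, (h v).1]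
  have hsum := σ.sum_cycleType
  rw [hsupp, card_univ, hct, Multiset.sum_replicate, smul_eq_mul] at hsum
  rw [hct]
  congr 1
  omega

/-- **Any two fixed-point-free involutions on finite sets of equal size are intertwined by a
bijection** (`θ ∘ φ = ψ ∘ θ`). [folklore] -/
theorem exists_intertwiner {α β : Type*} [Fintype α] [DecidableEq α] [Fintype β] [DecidableEq β]
    (e : α ≃ β) {φ : α → α} {ψ : β → β} (hφ : ∀ v, φ v ≠ v ∧ φ (φ v) = v)
    (hψ : ∀ v, ψ v ≠ v ∧ ψ (ψ v) = v) : ∃ θ : α ≃ β, ∀ a, θ (φ a) = ψ (θ a) := by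
  have hφi : Function.Involutive φ := fun v => (hφ v).2
  let ψ' : α → α := fun a => e.symm (ψ (e a))
  have hψi : Function.Involutive ψ' := fun v => by simp [ψ', (hψ _).2]
  have hψ'ne : ∀ v, ψ' v ≠ v := fun v hv => (hψ (e v)).1 (by
    have h' := congrArg e hv
    simpa [ψ'] using h')
  have hconj : IsConj (hφi.toPerm φ) (hψi.toPerm ψ') := by
    rw [Equiv.Perm.isConj_iff_cycleType_eq,
      cycleType_of_fpf_invol (hφi.toPerm φ) (fun v => by simpa using hφ v),
      cycleType_of_fpf_invol (hψi.toPerm ψ') (fun v => ⟨by simpa using hψ'ne v, by simp [hψi v]⟩)]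
  obtain ⟨c, hc⟩ := isConj_iff.1 hconj
  refine ⟨c.trans e, fun a => ?_⟩
  have h1 : c (φ a) = ψ' (c a) := by
    have h' := congrArg (fun π : Equiv.Perm α => π (c a)) hc
    simpa using h'
  show e (c (φ a)) = ψ (e (c a))
  rw [h1]
  simp [ψ']

/-- **The number of intertwiners `θ : α ≃ β` of two fixed-point-free involutions does not depend on
the target involution**: it equals the order of the centraliser of `φ` (the intertwiners form a
torsor under it). [folklore] -/
theorem card_intertwiners_eq {α β : Type*} [Fintype α] [DecidableEq α] [Fintype β] [DecidableEq β]
    (e : α ≃ β) {φ : α → α} {ψ : β → β} (hφ : ∀ v, φ v ≠ v ∧ φ (φ v) = v)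
    (hψ : ∀ v, ψ v ≠ v ∧ ψ (ψ v) = v) :
    ((univ : Finset (α ≃ β)).filter fun θ => ∀ a, θ (φ a) = ψ (θ a)).card =
      ((univ : Finset (α ≃ α)).filter fun θ => ∀ a, θ (φ a) = φ (θ a)).card := by
  obtain ⟨θ₀, h₀⟩ := exists_intertwiner e hφ hψ
  have h₀' : ∀ b, θ₀.symm (ψ b) = φ (θ₀.symm b) := fun b => by
    apply θ₀.injective
    rw [h₀, Equiv.apply_symm_apply, Equiv.apply_symm_apply]
  refine card_bij' (fun θ _ => θ.trans θ₀.symm) (fun σ _ => σ.trans θ₀) (fun θ hθ => ?_)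
    (fun σ hσ => ?_) (fun θ _ => ?_) (fun σ _ => ?_)
  · simp only [mem_filter, mem_univ, true_and] at hθ ⊢
    intro a
    simp [hθ a, h₀']
  · simp only [mem_filter, mem_univ, true_and] at hσ ⊢
    intro a
    simp [hσ a, h₀]
  · ext a
    simp
  · ext a
    simp

/-- The centraliser count is positive (the identity intertwines `φ` with itself). [folklore] -/
theorem card_self_intertwiners_pos {α : Type*} [Fintype α] [DecidableEq α] (φ : α → α) :
    0 < ((univ : Finset (α ≃ α)).filter fun θ => ∀ a, θ (φ a) = φ (θ a)).card :=
  card_pos.2 ⟨Equiv.refl α, by simp⟩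

end Rothvoss

end Literature.Computability.Complexity

/-!
# Part II — Re-choosing the core remainder among the big blocks: the big-block swap

In the proof of Lemma 15 of T. Rothvoss, *The matching polytope has exponential extension
complexity*, J. ACM 64 (2017) 41, the partition is generated in two phases: first `m+1` big blocks
`B̃₁, …, B̃_{m+1}` of size `2(k-3)` (the future `B₁, …, B_m` and the core remainder
`(C ∪ D) ∖ V(H)`), then the index of the block that becomes the core remainder. On the template the
core remainder is `cr ∪ dr`, indexed by `CoreV k = Fin (k-3) ⊕ Fin (k-3)` (`coreV`), and re-choosing
it is PRE-COMPOSITION of the encoding `τ` with the template involution `bigSwap j θ` exchanging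
`cr ∪ dr` with `Bⱼ` along `θ : CoreV k ≃ Fin (2(k-3))`.

For the weight `pU τ · [τ f₀ τ⁻¹ ∈ 𝓜]` of a FIXED template matching `f₀` to be invariant, `θ` must
intertwine the core component of `f₀` with its `Bⱼ`-component (`conj_bigSwap_eq_self`); such `θ`
exist and their number does not depend on `j` (Part I) — this is the paper's implicit conditioning
"`M*` does not cross `Cᵢ`, `Dᵢ`".

PROVED here: `bigSwap j θ` fixes all template cuts (`pU_bigSwap`), fixes `f₀` under the intertwining
condition, maps `ext₀` to itself (`conj_bigSwap_mem_ext₀`) exchanging the core component with the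
`Bⱼ`-component (`conj_bigSwap_b`), whence `p_{M,T}(H)` is invariant (`pH_bigSwap`) and
`p_{M,T'}(H ∪ g)` becomes a conditional probability on the `Bⱼ`-component (`pAll_bigSwap`); and
Corollary 11: an `ε₁`-unbiased (`ε₁ ≤ ε`) big block gives an `M`-good pair (`mgood_of_unbiased`).

## References

* T. Rothvoss, *The matching polytope has exponential extension complexity*, J. ACM 64(6) (2017)
  41:1–41:19, §3.5 (Cor. 11) and §3.6.2 (Lemma 15) [Rothvoss2017].
-/

namespace Literature.Computability.Complexity

open Finset
open Literature.Probability.LatticeModels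

namespace Rothvoss

open scoped Classical

variable {k m : ℕ}

/-! ### The core remainder as an index type; block components of a template map -/

/-- Indices of the core remainder `cr ∪ dr`: `inl x ↦ cr x`, `inr x ↦ dr x`. [cite: Rothvoss2017, §3.6.2] -/
abbrev CoreV (k : ℕ) : Type := Fin (k - 3) ⊕ Fin (k - 3)

/-- The core-remainder vertex with a given index. [cite: Rothvoss2017, §3.6.2] -/
def coreV : CoreV k → TV k m
  | .inl x => .cr x
  | .inr x => .dr x

/-- `coreV` is injective. [folklore] -/
theorem coreV_injective : Function.Injective (coreV : CoreV k → TV k m) := by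
  rintro (x | x) (y | y) h <;> simp only [coreV, TV.cr.injEq, TV.dr.injEq, reduceCtorEq] at h <;>
    simp [h]

/-- Core-remainder vertices have core-remainder labels. [folklore] -/
@[simp] theorem isCoreRem_lab_coreV (c : CoreV k) : (lab (coreV c : TV k m)).isCoreRem = true := by
  cases c <;> rfl

/-- Core-remainder vertices are not in small blocks. [folklore] -/
@[simp] theorem isSmall_lab_coreV (c : CoreV k) : (lab (coreV c : TV k m)).isSmall = false := by
  cases c <;> rfl

/-- Every vertex with a core-remainder label is some `coreV c`. [folklore] -/
theorem exists_coreV_of_isCoreRem {v : TV k m} (hv : (lab v).isCoreRem = true) : ∃ c, v = coreV c := by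
  cases v with
  | cr x => exact ⟨.inl x, rfl⟩
  | dr x => exact ⟨.inr x, rfl⟩
  | _ => simp [lab, Lab.isCoreRem] at hv

/-- A fixed identification of the core remainder with `2(k-3)` indices (the core remainder has the
size of a big block). [folklore] -/
def coreFinEquiv (k : ℕ) : CoreV k ≃ Fin (2 * (k - 3)) :=
  finSumFinEquiv.trans (finCongr (by omega))

/-- The core component of a template map: `f` read on `cr ∪ dr` through `coreV` (junk value `c` if
`f (coreV c)` is not a core-remainder vertex). [cite: Rothvoss2017, §3.6.2] -/
def coreMap (f : TV k m → TV k m) (c : CoreV k) : CoreV k :=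
  match f (coreV c) with
  | .cr x => .inl x
  | .dr x => .inr x
  | _ => c

/-- The `Aᵢ`-component of a template map (junk `x` if `f (a i x) ∉ A`). [cite: Rothvoss2017, §3.6.2] -/
def aMap (f : TV k m → TV k m) (i : Fin m) (x : Fin (k - 3)) : Fin (k - 3) :=
  match f (.a i x) with
  | .a _ x' => x'
  | _ => x

/-- The `Bⱼ`-component of a template map (junk `y` if `f (b j y) ∉ B`). [cite: Rothvoss2017, §3.6.2] -/
def bMap (f : TV k m → TV k m) (j : Fin m) (y : Fin (2 * (k - 3))) : Fin (2 * (k - 3)) :=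
  match f (.b j y) with
  | .b _ y' => y'
  | _ => y

/-- `coreMap` reads off `f` on the core remainder. [folklore] -/
theorem coreMap_of_eq {f : TV k m → TV k m} {c c' : CoreV k} (h : f (coreV c) = coreV c') :
    coreMap f c = c' := by
  unfold coreMap
  rw [h]
  cases c' <;> rfl

/-- `aMap` reads off `f` on `Aᵢ`. [folklore] -/
theorem aMap_of_eq {f : TV k m → TV k m} {i : Fin m} {x x' : Fin (k - 3)} (h : f (.a i x) = .a i x') :
    aMap f i x = x' := by
  unfold aMap
  rw [h]

/-- `bMap` reads off `f` on `Bⱼ`. [folklore] -/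
theorem bMap_of_eq {f : TV k m → TV k m} {j : Fin m} {y y' : Fin (2 * (k - 3))}
    (h : f (.b j y) = .b j y') : bMap f j y = y' := by
  unfold bMap
  rw [h]

/-- If `f (coreV c)` is a core-remainder vertex, it is `coreV (coreMap f c)`. [folklore] -/
theorem coreV_coreMap {f : TV k m → TV k m} {c : CoreV k}
    (h : (lab (f (coreV c))).isCoreRem = true) : coreV (coreMap f c) = f (coreV c) := by
  obtain ⟨c', hc'⟩ := exists_coreV_of_isCoreRem h
  rw [coreMap_of_eq hc', hc']

/-- If `f (a i x) ∈ Aᵢ`, it is `a i (aMap f i x)`. [folklore] -/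
theorem a_aMap {f : TV k m → TV k m} {i : Fin m} {x : Fin (k - 3)} (h : lab (f (.a i x)) = Lab.A i) :
    TV.a i (aMap f i x) = f (.a i x) := by
  obtain ⟨x', hx'⟩ := lab_eq_A_iff.1 h
  rw [aMap_of_eq hx', hx']

/-- A vertex with label `B j` is in block `Bⱼ`. [folklore] -/
theorem lab_eq_B_iff {v : TV k m} {j : Fin m} : lab v = Lab.B j ↔ ∃ y, v = TV.b j y := by
  cases v <;> simp [lab]

/-- If `f (b j y) ∈ Bⱼ`, it is `b j (bMap f j y)`. [folklore] -/
theorem b_bMap {f : TV k m → TV k m} {j : Fin m} {y : Fin (2 * (k - 3))}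
    (h : lab (f (.b j y)) = Lab.B j) : TV.b j (bMap f j y) = f (.b j y) := by
  obtain ⟨y', hy'⟩ := lab_eq_B_iff.1 h
  rw [bMap_of_eq hy', hy']

/-- For `f ∈ ext₀`: `f (coreV c) = coreV (coreMap f c)`. [folklore] -/
theorem ext₀_coreV {f : TV k m → TV k m} (hf : f ∈ ext₀ k m) (c : CoreV k) :
    f (coreV c) = coreV (coreMap f c) :=
  (coreV_coreMap ((mem_ext₀.1 hf).2.2.2 _ (isCoreRem_lab_coreV c))).symm

/-- For `f ∈ ext₀`: `f (a i x) = a i (aMap f i x)`. [folklore] -/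
theorem ext₀_a' {f : TV k m → TV k m} (hf : f ∈ ext₀ k m) (i : Fin m) (x : Fin (k - 3)) :
    f (.a i x) = .a i (aMap f i x) :=
  (a_aMap ((mem_ext₀.1 hf).2.2.1 (.a i x) rfl)).symm

/-- For `f ∈ ext₀`: `f (b j y) = b j (bMap f j y)`. [folklore] -/
theorem ext₀_b {f : TV k m → TV k m} (hf : f ∈ ext₀ k m) (j : Fin m) (y : Fin (2 * (k - 3))) :
    f (.b j y) = .b j (bMap f j y) :=
  (b_bMap ((mem_ext₀.1 hf).2.2.1 (.b j y) rfl)).symm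

/-- For `f ∈ ext₀`: `f (dh j) = ch j`. [folklore] -/
theorem ext₀_dh {f : TV k m → TV k m} (hf : f ∈ ext₀ k m) (j : Fin 3) : f (.dh j) = .ch j := by
  obtain ⟨hp, hH, -, -⟩ := mem_ext₀.1 hf
  rw [← hH j, (hp _).2]

/-- The core component of a map that is a fixed-point-free involution on the core remainder and
preserves it is a fixed-point-free involution of `CoreV k`. [folklore] -/
theorem coreMap_spec {f : TV k m → TV k m}
    (h1 : ∀ c : CoreV k, f (coreV c) ≠ coreV c ∧ f (f (coreV c)) = coreV c)
    (h2 : ∀ c : CoreV k, (lab (f (coreV c))).isCoreRem = true) (c : CoreV k) :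
    coreMap f c ≠ c ∧ coreMap f (coreMap f c) = c := by
  have e1 : coreV (coreMap f c) = f (coreV c) := coreV_coreMap (h2 c)
  have e2 : coreV (coreMap f (coreMap f c)) = f (coreV (m := m) (coreMap f c)) := coreV_coreMap (h2 _)
  refine ⟨fun h => (h1 c).1 ?_, coreV_injective (m := m) ?_⟩
  · rw [← e1, h]
  · rw [e2, e1, (h1 c).2]

/-- For `f ∈ ext₀`, `coreMap f` is a fixed-point-free involution. [folklore] -/
theorem coreMap_spec_ext₀ {f : TV k m → TV k m} (hf : f ∈ ext₀ k m) (c : CoreV k) :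
    coreMap f c ≠ c ∧ coreMap f (coreMap f c) = c :=
  coreMap_spec (fun _ => (mem_ext₀.1 hf).1 _) (fun c => (mem_ext₀.1 hf).2.2.2 _ (isCoreRem_lab_coreV c)) c

/-- For `g ∈ coreG`, `coreMap g` is a fixed-point-free involution. [folklore] -/
theorem coreMap_spec_coreG {g : TV k m → TV k m} (hg : g ∈ coreG k m) (c : CoreV k) :
    coreMap g c ≠ c ∧ coreMap g (coreMap g c) = c := by
  obtain ⟨-, hcore, -⟩ := mem_filter.1 hg
  exact coreMap_spec (fun c => ⟨(hcore _ (isCoreRem_lab_coreV c)).1, (hcore _ (isCoreRem_lab_coreV c)).2.1⟩)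
    (fun c => (hcore _ (isCoreRem_lab_coreV c)).2.2) c

/-- For `g ∈ coreG`: `g (coreV c) = coreV (coreMap g c)`. [folklore] -/
theorem coreG_coreV {g : TV k m → TV k m} (hg : g ∈ coreG k m) (c : CoreV k) :
    g (coreV c) = coreV (coreMap g c) := by
  obtain ⟨-, hcore, -⟩ := mem_filter.1 hg
  exact (coreV_coreMap (hcore _ (isCoreRem_lab_coreV c)).2.2).symm

/-- For `f ∈ ext₀`, `aMap f i` is a fixed-point-free involution. [folklore] -/
theorem aMap_spec_ext₀ {f : TV k m → TV k m} (hf : f ∈ ext₀ k m) (i : Fin m) (x : Fin (k - 3)) :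
    aMap f i x ≠ x ∧ aMap f i (aMap f i x) = x := by
  have hp := (mem_ext₀.1 hf).1
  have e1 := ext₀_a' hf i x
  have e2 := ext₀_a' hf i (aMap f i x)
  refine ⟨fun h => (hp (.a i x)).1 (by rw [e1, h]), ?_⟩
  have h3 := (hp (.a i x)).2
  rw [e1, e2] at h3
  exact (TV.a.inj h3).2

/-- For `f ∈ ext₀`, `bMap f j` is a fixed-point-free involution. [folklore] -/
theorem bMap_spec_ext₀ {f : TV k m → TV k m} (hf : f ∈ ext₀ k m) (j : Fin m) (y : Fin (2 * (k - 3))) :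
    bMap f j y ≠ y ∧ bMap f j (bMap f j y) = y := by
  have hp := (mem_ext₀.1 hf).1
  have e1 := ext₀_b hf j y
  have e2 := ext₀_b hf j (bMap f j y)
  refine ⟨fun h => (hp (.b j y)).1 (by rw [e1, h]), ?_⟩
  have h3 := (hp (.b j y)).2
  rw [e1, e2] at h3
  exact (TV.b.inj h3).2

/-! ### The big-block swap -/

/-- The template involution exchanging the core remainder `cr ∪ dr` with `Bⱼ` along `θ` (identity
on `A`, `ch`, `dh` and the other big blocks). [cite: Rothvoss2017, Lem. 15] -/
def bigSwapFun (j : Fin m) (θ : CoreV k ≃ Fin (2 * (k - 3))) : TV k m → TV k m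
  | .cr x => .b j (θ (.inl x))
  | .dr x => .b j (θ (.inr x))
  | .b i y => if i = j then coreV (θ.symm y) else .b i y
  | v => v

/-- `bigSwapFun` on the core remainder. [folklore] -/
theorem bigSwapFun_coreV (j : Fin m) (θ : CoreV k ≃ Fin (2 * (k - 3))) (c : CoreV k) :
    bigSwapFun j θ (coreV c : TV k m) = .b j (θ c) := by
  cases c <;> rfl

/-- `bigSwapFun` on `Bⱼ`. [folklore] -/
@[simp] theorem bigSwapFun_b_same (j : Fin m) (θ : CoreV k ≃ Fin (2 * (k - 3)))
    (y : Fin (2 * (k - 3))) : bigSwapFun j θ (.b j y : TV k m) = coreV (θ.symm y) := by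
  simp [bigSwapFun]

/-- `bigSwapFun` fixes the other big blocks. [folklore] -/
theorem bigSwapFun_b_ne {i j : Fin m} (h : i ≠ j) (θ : CoreV k ≃ Fin (2 * (k - 3)))
    (y : Fin (2 * (k - 3))) : bigSwapFun j θ (.b i y : TV k m) = .b i y := by
  simp [bigSwapFun, h]

/-- `bigSwapFun` fixes `A`. [folklore] -/
@[simp] theorem bigSwapFun_a (j : Fin m) (θ : CoreV k ≃ Fin (2 * (k - 3))) (i : Fin m)
    (x : Fin (k - 3)) : bigSwapFun j θ (.a i x : TV k m) = .a i x := rfl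

/-- `bigSwapFun` fixes `ch`. [folklore] -/
@[simp] theorem bigSwapFun_ch (j : Fin m) (θ : CoreV k ≃ Fin (2 * (k - 3))) (i : Fin 3) :
    bigSwapFun j θ (.ch i : TV k m) = .ch i := rfl

/-- `bigSwapFun` fixes `dh`. [folklore] -/
@[simp] theorem bigSwapFun_dh (j : Fin m) (θ : CoreV k ≃ Fin (2 * (k - 3))) (i : Fin 3) :
    bigSwapFun j θ (.dh i : TV k m) = .dh i := rfl

/-- `bigSwapFun j θ` is an involution. [folklore] -/
theorem bigSwapFun_invol (j : Fin m) (θ : CoreV k ≃ Fin (2 * (k - 3))) (v : TV k m) :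
    bigSwapFun j θ (bigSwapFun j θ v) = v := by
  cases v with
  | cr x =>
    show bigSwapFun j θ (.b j (θ (.inl x))) = _
    rw [bigSwapFun_b_same, Equiv.symm_apply_apply]
    rfl
  | dr x =>
    show bigSwapFun j θ (.b j (θ (.inr x))) = _
    rw [bigSwapFun_b_same, Equiv.symm_apply_apply]
    rfl
  | b i y =>
    by_cases h : i = j
    · subst h
      rw [bigSwapFun_b_same, bigSwapFun_coreV, Equiv.apply_symm_apply]
    · rw [bigSwapFun_b_ne h, bigSwapFun_b_ne h]
  | _ => rfl

/-- **The big-block swap** `cr ∪ dr ↔ Bⱼ` along `θ`, as a template permutation.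
[cite: Rothvoss2017, Lem. 15] -/
def bigSwap (j : Fin m) (θ : CoreV k ≃ Fin (2 * (k - 3))) : TV k m ≃ TV k m :=
  ⟨bigSwapFun j θ, bigSwapFun j θ, bigSwapFun_invol j θ, bigSwapFun_invol j θ⟩

/-- `bigSwap` acts by `bigSwapFun`. [folklore] -/
@[simp] theorem bigSwap_apply (j : Fin m) (θ : CoreV k ≃ Fin (2 * (k - 3))) (v : TV k m) :
    bigSwap j θ v = bigSwapFun j θ v := rfl

/-- `bigSwap` is its own inverse. [folklore] -/
@[simp] theorem bigSwap_symm_apply (j : Fin m) (θ : CoreV k ≃ Fin (2 * (k - 3))) (v : TV k m) :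
    (bigSwap j θ).symm v = bigSwapFun j θ v := rfl

/-- Conjugating twice by the involution `bigSwap j θ` is the identity. [folklore] -/
theorem conj_bigSwap_conj_bigSwap (j : Fin m) (θ : CoreV k ≃ Fin (2 * (k - 3)))
    (f : TV k m → TV k m) : conj (bigSwap j θ) (conj (bigSwap j θ) f) = f := by
  funext v
  simp [conj, bigSwapFun_invol]

/-- Unfolding `conj (bigSwap j θ) f`. [folklore] -/
theorem conj_bigSwap_apply (j : Fin m) (θ : CoreV k ≃ Fin (2 * (k - 3))) (f : TV k m → TV k m)
    (v : TV k m) : conj (bigSwap j θ) f v = bigSwapFun j θ (f (bigSwapFun j θ v)) := rfl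

/-! ### Invariance of the template cuts and of an intertwined `f₀` -/

/-- The big-block swap fixes every `Q₃`-template cut (cuts live on `ch ∪ A`). [cite: Rothvoss2017, Lem. 15] -/
theorem map_cut₀_bigSwap (I : Finset (Fin m)) (j : Fin m) (θ : CoreV k ≃ Fin (2 * (k - 3))) :
    (cut₀ I : Finset (TV k m)).map (bigSwap j θ).toEmbedding = cut₀ I := by
  refine map_eq_of_subset fun v hv => ?_
  rw [mem_map] at hv
  obtain ⟨u, hu, rfl⟩ := hv
  rw [mem_cut₀] at hu
  cases u <;> simp_all [cutMem, bigSwapFun]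

/-- **`p^ex_{U,T}(H)` is invariant under the big-block swap.** [cite: Rothvoss2017, Lem. 15] -/
theorem pU_bigSwap (𝓤 : Finset (Finset (Fin (rvN k m)))) (j : Fin m)
    (θ : CoreV k ≃ Fin (2 * (k - 3))) (τ : Bij k m) :
    pU k m 𝓤 ((bigSwap j θ).trans τ) = pU k m 𝓤 τ := by
  unfold pU
  have h : ((cuts₀ k m).filter fun U₀ => U₀.map ((bigSwap j θ).trans τ).toEmbedding ∈ 𝓤) =
      (cuts₀ k m).filter fun U₀ => U₀.map τ.toEmbedding ∈ 𝓤 := by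
    refine filter_congr fun U₀ hU₀ => ?_
    obtain ⟨I, -, rfl⟩ := mem_image.1 hU₀
    rw [Equiv.trans_toEmbedding, ← map_map, map_cut₀_bigSwap]
  rw [h]

/-- **An intertwined template matching is fixed by the big-block swap**: if `θ` carries the core
component of `f ∈ ext₀` to its `Bⱼ`-component, then `(bigSwap j θ) f (bigSwap j θ)⁻¹ = f`.
[cite: Rothvoss2017, Lem. 15] -/
theorem conj_bigSwap_eq_self {f : TV k m → TV k m} (hf : f ∈ ext₀ k m) {j : Fin m}
    {θ : CoreV k ≃ Fin (2 * (k - 3))} (hθ : ∀ c, θ (coreMap f c) = bMap f j (θ c)) :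
    conj (bigSwap j θ) f = f := by
  obtain ⟨hp, hH, hsmall, hcore⟩ := mem_ext₀.1 hf
  funext v
  rw [conj_bigSwap_apply]
  cases v with
  | cr x =>
    rw [show (TV.cr x : TV k m) = coreV (.inl x) from rfl, bigSwapFun_coreV, ext₀_b hf, ← hθ,
      bigSwapFun_b_same, Equiv.symm_apply_apply, ext₀_coreV hf]
  | dr x =>
    rw [show (TV.dr x : TV k m) = coreV (.inr x) from rfl, bigSwapFun_coreV, ext₀_b hf, ← hθ,
      bigSwapFun_b_same, Equiv.symm_apply_apply, ext₀_coreV hf]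
  | b i y =>
    by_cases h : i = j
    · subst h
      rw [bigSwapFun_b_same, ext₀_coreV hf, bigSwapFun_coreV, hθ, Equiv.apply_symm_apply, ext₀_b hf]
    · rw [bigSwapFun_b_ne h, ext₀_b hf, bigSwapFun_b_ne h]
  | a i x => rw [bigSwapFun_a, ext₀_a' hf, bigSwapFun_a]
  | ch i => rw [bigSwapFun_ch, hH, bigSwapFun_dh]
  | dh i => rw [bigSwapFun_dh, ext₀_dh hf, bigSwapFun_ch]

/-! ### The big-block swap on `ext₀` -/

/-- **Conjugation by the big-block swap preserves `ext₀`** (it exchanges the core component with the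
`Bⱼ`-component). [cite: Rothvoss2017, Lem. 15] -/
theorem conj_bigSwap_mem_ext₀ {f : TV k m → TV k m} (hf : f ∈ ext₀ k m) (j : Fin m)
    (θ : CoreV k ≃ Fin (2 * (k - 3))) : conj (bigSwap j θ) f ∈ ext₀ k m := by
  obtain ⟨hp, hH, hsmall, hcore⟩ := mem_ext₀.1 hf
  refine mem_ext₀.2 ⟨conj_spec _ hp, fun i => ?_, fun v hv => ?_, fun v hv => ?_⟩
  · rw [conj_bigSwap_apply, bigSwapFun_ch, hH, bigSwapFun_dh]
  · rw [conj_bigSwap_apply]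
    cases v with
    | a i x => rw [bigSwapFun_a, ext₀_a' hf, bigSwapFun_a]; rfl
    | b i y =>
      by_cases h : i = j
      · subst h
        rw [bigSwapFun_b_same, ext₀_coreV hf, bigSwapFun_coreV]
        rfl
      · rw [bigSwapFun_b_ne h, ext₀_b hf, bigSwapFun_b_ne h]
        rfl
    | _ => simp [lab, Lab.isSmall] at hv
  · obtain ⟨c, rfl⟩ := exists_coreV_of_isCoreRem hv
    rw [conj_bigSwap_apply, bigSwapFun_coreV, ext₀_b hf, bigSwapFun_b_same]
    exact isCoreRem_lab_coreV _

/-- The core-remainder matching `g` transported to `Bⱼ`-indices along `θ`: `θ g θ⁻¹`.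
[cite: Rothvoss2017, Lem. 15] -/
def trB (θ : CoreV k ≃ Fin (2 * (k - 3))) (g : TV k m → TV k m) (y : Fin (2 * (k - 3))) :
    Fin (2 * (k - 3)) :=
  θ (coreMap g (θ.symm y))

/-- `trB θ g` is a fixed-point-free involution for `g ∈ coreG`. [folklore] -/
theorem trB_spec (θ : CoreV k ≃ Fin (2 * (k - 3))) {g : TV k m → TV k m} (hg : g ∈ coreG k m)
    (y : Fin (2 * (k - 3))) : trB θ g y ≠ y ∧ trB θ g (trB θ g y) = y := by
  have h := coreMap_spec_coreG hg (θ.symm y)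
  refine ⟨fun hy => h.1 ?_, ?_⟩
  · apply θ.injective
    rw [Equiv.apply_symm_apply]
    exact hy
  · simp only [trB, Equiv.symm_apply_apply, h.2, Equiv.apply_symm_apply]

/-- **The swapped matching on `Bⱼ`**: `(bigSwap j θ) f (bigSwap j θ)⁻¹` restricted to `Bⱼ` is the core
component of `f` transported along `θ`. [cite: Rothvoss2017, Lem. 15] -/
theorem conj_bigSwap_b {f : TV k m → TV k m} (hf : f ∈ ext₀ k m) (j : Fin m)
    (θ : CoreV k ≃ Fin (2 * (k - 3))) (y : Fin (2 * (k - 3))) :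
    conj (bigSwap j θ) f (.b j y) = .b j (trB θ f y) := by
  rw [conj_bigSwap_apply, bigSwapFun_b_same, ext₀_coreV hf, bigSwapFun_coreV]
  rfl

/-- `f ∈ ext₀` agrees with `g ∈ coreG` on the core remainder iff their transports to `Bⱼ`-indices
agree. [folklore] -/
theorem core_eq_iff_trB_eq {f g : TV k m → TV k m} (hf : f ∈ ext₀ k m) (hg : g ∈ coreG k m)
    (θ : CoreV k ≃ Fin (2 * (k - 3))) :
    (∀ v, (lab v).isCoreRem = true → f v = g v) ↔ ∀ y, trB θ f y = trB θ g y := by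
  constructor
  · intro h y
    simp only [trB]
    congr 1
    apply coreV_injective (m := m)
    rw [← ext₀_coreV hf, ← coreG_coreV hg, h _ (isCoreRem_lab_coreV _)]
  · intro h v hv
    obtain ⟨c, rfl⟩ := exists_coreV_of_isCoreRem hv
    have h1 := h (θ c)
    simp only [trB, Equiv.symm_apply_apply] at h1
    rw [ext₀_coreV hf, coreG_coreV hg, θ.injective h1]

/-- **`p_{M,T}(H)` is invariant under the big-block swap** (conjugation permutes `ext₀`).
[cite: Rothvoss2017, Lem. 15] -/
theorem pH_bigSwap (𝓜 : Finset ((⊤ : SimpleGraph (Fin (rvN k m))).Subgraph)) (j : Fin m)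
    (θ : CoreV k ≃ Fin (2 * (k - 3))) (τ : Bij k m) :
    pH k m 𝓜 ((bigSwap j θ).trans τ) = pH k m 𝓜 τ := by
  unfold pH
  congr 2
  refine card_bij' (fun f _ => conj (bigSwap j θ) f) (fun f _ => conj (bigSwap j θ) f)
    (fun f hf => ?_) (fun f hf => ?_) (fun f _ => conj_bigSwap_conj_bigSwap _ _ _)
    (fun f _ => conj_bigSwap_conj_bigSwap _ _ _)
  · obtain ⟨hf, hM⟩ := mem_filter.1 hf
    refine mem_filter.2 ⟨conj_bigSwap_mem_ext₀ hf j θ, ?_⟩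
    rwa [← toSub_trans _ _ (mem_ext₀.1 hf).1]
  · obtain ⟨hf, hM⟩ := mem_filter.1 hf
    refine mem_filter.2 ⟨conj_bigSwap_mem_ext₀ hf j θ, ?_⟩
    rw [toSub_trans _ _ (mem_ext₀.1 (conj_bigSwap_mem_ext₀ hf j θ)).1, conj_bigSwap_conj_bigSwap]
    exact hM

/-- The numerator count of `p_{M,T}(H)` is invariant under the big-block swap. [cite: Rothvoss2017, Lem. 15] -/
theorem card_ext₀_filter_bigSwap (𝓜 : Finset ((⊤ : SimpleGraph (Fin (rvN k m))).Subgraph))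
    (j : Fin m) (θ : CoreV k ≃ Fin (2 * (k - 3))) (τ : Bij k m) :
    ((ext₀ k m).filter fun f => toSub ((bigSwap j θ).trans τ) f ∈ 𝓜).card =
      ((ext₀ k m).filter fun f => toSub τ f ∈ 𝓜).card := by
  refine card_bij' (fun f _ => conj (bigSwap j θ) f) (fun f _ => conj (bigSwap j θ) f)
    (fun f hf => ?_) (fun f hf => ?_) (fun f _ => conj_bigSwap_conj_bigSwap _ _ _)
    (fun f _ => conj_bigSwap_conj_bigSwap _ _ _)
  · obtain ⟨hf, hM⟩ := mem_filter.1 hf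
    refine mem_filter.2 ⟨conj_bigSwap_mem_ext₀ hf j θ, ?_⟩
    rwa [← toSub_trans _ _ (mem_ext₀.1 hf).1]
  · obtain ⟨hf, hM⟩ := mem_filter.1 hf
    refine mem_filter.2 ⟨conj_bigSwap_mem_ext₀ hf j θ, ?_⟩
    rw [toSub_trans _ _ (mem_ext₀.1 (conj_bigSwap_mem_ext₀ hf j θ)).1, conj_bigSwap_conj_bigSwap]
    exact hM

/-- **`p_{M,T'}(H ∪ g)` after the big-block swap is a conditional probability on the
`Bⱼ`-component**: for `T' = ` the partition encoded by `bigSwap j θ ∘ τ`,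
`p_{M,T'}(H ∪ g) = #{f ∈ ext₀ : f|_{Bⱼ} = θ g θ⁻¹, τ f τ⁻¹ ∈ 𝓜} / #{f ∈ ext₀ : f|_{Bⱼ} = θ g θ⁻¹}`.
[cite: Rothvoss2017, Lem. 15] -/
theorem pAll_bigSwap (𝓜 : Finset ((⊤ : SimpleGraph (Fin (rvN k m))).Subgraph))
    {g : TV k m → TV k m} (hg : g ∈ coreG k m) (j : Fin m) (θ : CoreV k ≃ Fin (2 * (k - 3)))
    (τ : Bij k m) :
    pAll k m 𝓜 ((bigSwap j θ).trans τ) g =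
      (((ext₀ k m).filter fun f => (∀ y, f (.b j y) = .b j (trB θ g y)) ∧ toSub τ f ∈ 𝓜).card : ℝ) /
        ((ext₀ k m).filter fun f => ∀ y, f (.b j y) = .b j (trB θ g y)).card := by
  -- the fibre of `g` is carried onto the `Bⱼ`-fibre of `θ g θ⁻¹` by conjugation
  have key : ∀ f, f ∈ ext₀ k m → ((∀ v, (lab v).isCoreRem = true → f v = g v) ↔
      ∀ y, conj (bigSwap j θ) f (.b j y) = .b j (trB θ g y)) := fun f hf => by
    rw [core_eq_iff_trB_eq hf hg θ]
    refine forall_congr' fun y => ?_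
    rw [conj_bigSwap_b hf]
    simp
  have hbij : ∀ (P : (TV k m → TV k m) → Prop),
      ((matsAll₀ g).filter fun f => P (conj (bigSwap j θ) f)).card =
        ((ext₀ k m).filter fun f => (∀ y, f (.b j y) = .b j (trB θ g y)) ∧ P f).card := by
    intro P
    refine card_bij' (fun f _ => conj (bigSwap j θ) f) (fun f _ => conj (bigSwap j θ) f)
      (fun f hf => ?_) (fun f hf => ?_) (fun f _ => conj_bigSwap_conj_bigSwap _ _ _)
      (fun f _ => conj_bigSwap_conj_bigSwap _ _ _)
    · obtain ⟨hf, hP⟩ := mem_filter.1 hf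
      obtain ⟨hfe, hfg⟩ := mem_matsAll₀.1 hf
      exact mem_filter.2 ⟨conj_bigSwap_mem_ext₀ hfe j θ, (key f hfe).1 hfg, hP⟩
    · obtain ⟨hfe, hfib, hP⟩ := mem_filter.1 hf
      have hfe' := conj_bigSwap_mem_ext₀ hfe j θ
      refine mem_filter.2 ⟨mem_matsAll₀.2 ⟨hfe', (key _ hfe').2 ?_⟩, ?_⟩
      · intro y
        rw [conj_bigSwap_conj_bigSwap]
        exact hfib y
      · rwa [conj_bigSwap_conj_bigSwap]
  unfold pAll
  have hnum : ((matsAll₀ g).filter fun f => toSub ((bigSwap j θ).trans τ) f ∈ 𝓜).card =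
      ((ext₀ k m).filter fun f => (∀ y, f (.b j y) = .b j (trB θ g y)) ∧ toSub τ f ∈ 𝓜).card := by
    have h := hbij (fun f => toSub τ f ∈ 𝓜)
    beta_reduce at h
    have e : ((matsAll₀ g).filter fun f => toSub ((bigSwap j θ).trans τ) f ∈ 𝓜) =
        (matsAll₀ g).filter fun f => toSub τ (conj (bigSwap j θ) f) ∈ 𝓜 :=
      filter_congr fun f hf => by rw [toSub_trans _ _ (mem_ext₀.1 (mem_matsAll₀.1 hf).1).1]
    rw [e]
    convert h using 3
  have hden : (matsAll₀ g).card =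
      ((ext₀ k m).filter fun f => ∀ y, f (.b j y) = .b j (trB θ g y)).card := by
    simpa using hbij (fun _ => True)
  rw [hnum, hden]

/-! ### Corollary 11: an unbiased big block gives an `M`-good pair -/

/-- The arithmetic of Corollary 11 of Rothvoss 2017 (Bayes): if the fibre count `N` of `𝓨` over a
coordinate value is `ε₁`-unbiased, `|𝓨|/((1+ε₁) q) ≤ N ≤ (1+ε₁)|𝓨|/q`, and every fibre of the ambient
product has size `D = |X|/q`, then the conditional probability `N/D` is within `1+ε` of `|𝓨|/|X|`
(`ε₁ ≤ ε`). [cite: Rothvoss2017, Cor. 11] -/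
theorem cond_prob_bounds_of_unbiased {ε ε₁ Yc N D q : ℝ} (hε₁ : 0 ≤ ε₁) (hε : ε₁ ≤ ε) (hq : 0 < q)
    (hD : 0 < D) (hN : 0 ≤ N) (hYc : 0 ≤ Yc)
    (hl : Yc / ((1 + ε₁) * q) ≤ N) (hu : N ≤ (1 + ε₁) * Yc / q) :
    Yc / (D * q) / (1 + ε) ≤ N / D ∧ N / D ≤ (1 + ε) * (Yc / (D * q)) := by
  have hε1 : (0 : ℝ) < 1 + ε₁ := by linarith
  have hε0 : (0 : ℝ) < 1 + ε := by linarith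
  have hq' : 0 ≤ q := hq.le
  rw [div_le_iff₀ (mul_pos hε1 hq)] at hl
  rw [le_div_iff₀ hq] at hu
  have h1 : Yc ≤ N * ((1 + ε) * q) := hl.trans (by gcongr)
  have h2 : N * q ≤ (1 + ε) * Yc := hu.trans (by gcongr)
  have h1' := mul_le_mul_of_nonneg_right h1 hD.le
  have h2' := mul_le_mul_of_nonneg_right h2 hD.le
  constructor
  · rw [div_div, div_le_div_iff₀ (mul_pos (mul_pos hD hq) hε0) hD]
    linarith
  · rw [← mul_div_assoc, div_le_div_iff₀ hD (mul_pos hD hq)]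
    linarith

/-- **Corollary 11 of Rothvoss 2017 ⇒ `M`-goodness.** After re-choosing big block `j` as the core
remainder (encoding `bigSwap j θ ∘ τ`), the pair is `M`-good as soon as `p_{M,T}(H) > 0` and the
`Bⱼ`-component is `ε₁`-unbiased (`ε₁ ≤ ε`) for `𝓨 = {f ∈ ext₀ : τ f τ⁻¹ ∈ 𝓜}`, given that every
`Bⱼ`-fibre of `ext₀` has size `|ext₀| / q` (`q = ` the number of perfect matchings of a big block).
[cite: Rothvoss2017, Cor. 11 & Lem. 15] -/
theorem mgood_of_unbiased {ε ε₁ : ℝ} (hε₁ : 0 ≤ ε₁) (hε : ε₁ ≤ ε)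
    {𝓜 : Finset ((⊤ : SimpleGraph (Fin (rvN k m))).Subgraph)} {τ : Bij k m} (j : Fin m)
    (θ : CoreV k ≃ Fin (2 * (k - 3))) {q : ℕ} (hq : 0 < q) (hpos : 0 < pH k m 𝓜 τ)
    (hD : ∀ ψ : Fin (2 * (k - 3)) → Fin (2 * (k - 3)), (∀ y, ψ y ≠ y ∧ ψ (ψ y) = y) →
      ((ext₀ k m).filter fun f => ∀ y, f (.b j y) = .b j (ψ y)).card * q = (ext₀ k m).card)
    (hunb : ∀ ψ : Fin (2 * (k - 3)) → Fin (2 * (k - 3)), (∀ y, ψ y ≠ y ∧ ψ (ψ y) = y) →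
      (((ext₀ k m).filter fun f => toSub τ f ∈ 𝓜).card : ℝ) / ((1 + ε₁) * q) ≤
        ((ext₀ k m).filter fun f => (∀ y, f (.b j y) = .b j (ψ y)) ∧ toSub τ f ∈ 𝓜).card ∧
      (((ext₀ k m).filter fun f => (∀ y, f (.b j y) = .b j (ψ y)) ∧ toSub τ f ∈ 𝓜).card : ℝ) ≤
        (1 + ε₁) * ((ext₀ k m).filter fun f => toSub τ f ∈ 𝓜).card / q) :
    MGood k m 𝓜 ε ((bigSwap j θ).trans τ) := by
  have hE : (0 : ℝ) < (ext₀ k m).card := by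
    unfold pH at hpos
    by_contra h
    push Not at h
    have h0 : ((ext₀ k m).card : ℝ) = 0 := le_antisymm h (Nat.cast_nonneg _)
    rw [h0, div_zero] at hpos
    exact lt_irrefl _ hpos
  have hqpos : (0 : ℝ) < q := by exact_mod_cast hq
  unfold MGood
  rw [pH_bigSwap]
  refine ⟨hpos, fun g hg => ?_⟩
  rw [pAll_bigSwap 𝓜 hg]
  obtain ⟨hl, hu⟩ := hunb (trB θ g) (trB_spec θ hg)
  have hDq : ((((ext₀ k m).filter fun f => ∀ y, f (.b j y) = .b j (trB θ g y)).card : ℕ) : ℝ) * q =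
      (ext₀ k m).card := by
    exact_mod_cast hD (trB θ g) (trB_spec θ hg)
  have hDpos : (0 : ℝ) <
      ((((ext₀ k m).filter fun f => ∀ y, f (.b j y) = .b j (trB θ g y)).card : ℕ) : ℝ) := by
    by_contra h
    push Not at h
    have h' := mul_nonpos_of_nonpos_of_nonneg h hqpos.le
    linarith
  have hpH : pH k m 𝓜 τ = (((ext₀ k m).filter fun f => toSub τ f ∈ 𝓜).card : ℝ) /
      (((((ext₀ k m).filter fun f => ∀ y, f (.b j y) = .b j (trB θ g y)).card : ℕ) : ℝ) * q) := by
    unfold pH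
    rw [hDq]
  rw [hpH]
  exact cond_prob_bounds_of_unbiased hε₁ hε hqpos hDpos (Nat.cast_nonneg _) (Nat.cast_nonneg _)
    hl hu

end Rothvoss

end Literature.Computability.Complexity

/-!
# Part III — The block product: `ext₀ ≃ ∏_{blocks} PM(block)`

In the proof of Lemma 15 of T. Rothvoss, *The matching polytope has exponential extension
complexity*, J. ACM 64 (2017) 41, the matchings `M ∈ 𝓜(T)` with `H ⊆ M` are the product
`X = X₁ × ⋯ × X_{2m+1}` of the perfect matchings of the blocks `B̃₁, …, B̃_{m+1}` (the big blocks and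
the core remainder) and `A₁, …, A_m`. On the template: `ext₀ k m` is in bijection (`glue` / `coords`)
with `∏_{b : BIdx m} PMf (BV k b)`, where `BIdx m = Option (Fin m ⊕ Fin m)` indexes the blocks
(`none` = core remainder `cr ∪ dr`, `inl i` = `Aᵢ`, `inr i` = `Bᵢ`) and `PMf α` is the type of
fixed-point-free involutions (= perfect matchings, as partner maps) of `α`.

PROVED here: the bijection (`glue_mem_ext₀`, `glue_coords`, `coords_glue`), the transfer of counts
(`card_ext₀_eq`, `card_filter_ext₀`), the size of a coordinate fibre of a finite product
(`card_filter_apply_eq_mul`), hence `#{f ∈ ext₀ : f|_{Bⱼ} = ψ} · |PM(Bⱼ)| = |ext₀|`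
(`card_ext₀_fibre_b`), `|matsAll₀ g| · |PM(cr ∪ dr)| = |ext₀|` (`card_matsAll₀_mul`) and the crude
comparison `|ext₀| ≤ |PM(cr ∪ dr)| · |mats₀|` (`card_ext₀_le`) used for the density estimate
`|Y| ≥ 2^{-δ m} ∏_{j ≠ i} |X_j|` of the paper.

## References

* T. Rothvoss, *The matching polytope has exponential extension complexity*, J. ACM 64(6) (2017)
  41:1–41:19, §3.6.2 (Lemma 15) [Rothvoss2017].
-/

namespace Literature.Computability.Complexity

open Finset
open Literature.Probability.LatticeModels

namespace Rothvoss

open scoped Classical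

variable {k m : ℕ}

/-! ### Blocks and their perfect matchings -/

/-- The fixed-point-free involutions (perfect matchings, as partner maps) of a type. [folklore] -/
abbrev PMf (α : Type*) := {φ : α → α // ∀ v, φ v ≠ v ∧ φ (φ v) = v}

/-- Block indices: `none` = the core remainder, `some (inl i)` = `Aᵢ`, `some (inr i)` = `Bᵢ`
(the `2m+1` factors of the paper's `X`). [cite: Rothvoss2017, Lem. 15] -/
abbrev BIdx (m : ℕ) : Type := Option (Fin m ⊕ Fin m)

/-- `|BIdx m| = 2m + 1`. [cite: Rothvoss2017, Lem. 15] -/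
theorem card_BIdx (m : ℕ) : Fintype.card (BIdx m) = 2 * m + 1 := by
  simp [Fintype.card_option, Fintype.card_sum]
  ring

variable (k) in
/-- The vertex-index type of a block. [cite: Rothvoss2017, Lem. 15] -/
def BV : BIdx m → Type
  | none => CoreV k
  | some (.inl _) => Fin (k - 3)
  | some (.inr _) => Fin (2 * (k - 3))

/-- Each block index type is finite. [folklore] -/
instance instFintypeBV (b : BIdx m) : Fintype (BV k b) := by
  rcases b with _ | ⟨_ | _⟩ <;> dsimp [BV] <;> infer_instance

/-- Each block index type has decidable equality. [folklore] -/
instance instDecidableEqBV (b : BIdx m) : DecidableEq (BV k b) := by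
  rcases b with _ | ⟨_ | _⟩ <;> dsimp [BV] <;> infer_instance

/-! ### Gluing block matchings, and reading off block components -/

/-- **Gluing**: the template matching with prescribed block components (and `H₀` on `ch ∪ dh`).
[cite: Rothvoss2017, Lem. 15] -/
def glue (y : (b : BIdx m) → PMf (BV k b)) : TV k m → TV k m
  | .a i x => .a i ((y (some (.inl i))).1 x)
  | .b i x => .b i ((y (some (.inr i))).1 x)
  | .cr x => coreV ((y none).1 (.inl x))
  | .dr x => coreV ((y none).1 (.inr x))
  | .ch j => .dh j
  | .dh j => .ch j

/-- `glue` on the core remainder. [folklore] -/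
theorem glue_coreV (y : (b : BIdx m) → PMf (BV k b)) (c : CoreV k) :
    glue y (coreV c) = coreV ((y none).1 c) := by
  cases c <;> rfl

/-- `glue` on `Bᵢ`. [folklore] -/
@[simp] theorem glue_b (y : (b : BIdx m) → PMf (BV k b)) (i : Fin m) (x : Fin (2 * (k - 3))) :
    glue y (.b i x) = .b i ((y (some (.inr i))).1 x) := rfl

/-- `glue` on `Aᵢ`. [folklore] -/
@[simp] theorem glue_a (y : (b : BIdx m) → PMf (BV k b)) (i : Fin m) (x : Fin (k - 3)) :
    glue y (.a i x) = .a i ((y (some (.inl i))).1 x) := rfl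

/-- **Glued matchings lie in `ext₀`.** [cite: Rothvoss2017, Lem. 15] -/
theorem glue_mem_ext₀ (y : (b : BIdx m) → PMf (BV k b)) : glue y ∈ ext₀ k m := by
  refine mem_ext₀.2 ⟨fun v => ?_, fun j => rfl, fun v hv => ?_, fun v hv => ?_⟩
  · cases v with
    | a i x =>
      have h := (y (some (.inl i))).2 x
      refine ⟨fun e => h.1 (TV.a.inj e).2, ?_⟩
      show TV.a i ((y (some (.inl i))).1 ((y (some (.inl i))).1 x)) = TV.a i x
      rw [h.2]
    | b i x =>
      have h := (y (some (.inr i))).2 x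
      refine ⟨fun e => h.1 (TV.b.inj e).2, ?_⟩
      show TV.b i ((y (some (.inr i))).1 ((y (some (.inr i))).1 x)) = TV.b i x
      rw [h.2]
    | cr x =>
      have h := (y none).2 (.inl x)
      constructor
      · show coreV ((y none).1 (.inl x)) ≠ (coreV (.inl x) : TV k m)
        exact fun e => h.1 (coreV_injective e)
      · show glue y (coreV ((y none).1 (.inl x))) = coreV (.inl x)
        rw [glue_coreV, h.2]
    | dr x =>
      have h := (y none).2 (.inr x)
      constructor
      · show coreV ((y none).1 (.inr x)) ≠ (coreV (.inr x) : TV k m)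
        exact fun e => h.1 (coreV_injective e)
      · show glue y (coreV ((y none).1 (.inr x))) = coreV (.inr x)
        rw [glue_coreV, h.2]
    | ch j => exact ⟨by simp [glue], rfl⟩
    | dh j => exact ⟨by simp [glue], rfl⟩
  · cases v with
    | a i x => rfl
    | b i x => rfl
    | _ => simp [lab, Lab.isSmall] at hv
  · obtain ⟨c, rfl⟩ := exists_coreV_of_isCoreRem hv
    rw [glue_coreV]
    exact isCoreRem_lab_coreV _

/-- **Block components** of a matching of `ext₀`. [cite: Rothvoss2017, Lem. 15] -/
def coords (f : TV k m → TV k m) (hf : f ∈ ext₀ k m) : (b : BIdx m) → PMf (BV k b)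
  | none => ⟨coreMap f, coreMap_spec_ext₀ hf⟩
  | some (.inl i) => ⟨aMap f i, aMap_spec_ext₀ hf i⟩
  | some (.inr i) => ⟨bMap f i, bMap_spec_ext₀ hf i⟩

/-- `coords ∘ glue = id`. [folklore] -/
theorem coords_glue (y : (b : BIdx m) → PMf (BV k b)) : coords (glue y) (glue_mem_ext₀ y) = y := by
  funext b
  rcases b with _ | ⟨i | i⟩
  · apply Subtype.ext
    funext c
    show coreMap (glue y) c = (y none).1 c
    exact coreMap_of_eq (glue_coreV y c)
  · apply Subtype.ext
    funext x
    show aMap (glue y) i x = (y (some (.inl i))).1 x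
    exact aMap_of_eq rfl
  · apply Subtype.ext
    funext x
    show bMap (glue y) i x = (y (some (.inr i))).1 x
    exact bMap_of_eq rfl

/-- `glue ∘ coords = id` on `ext₀`. [folklore] -/
theorem glue_coords {f : TV k m → TV k m} (hf : f ∈ ext₀ k m) : glue (coords f hf) = f := by
  funext v
  cases v with
  | a i x => exact (ext₀_a' hf i x).symm
  | b i x => exact (ext₀_b hf i x).symm
  | cr x => exact (ext₀_coreV hf (.inl x)).symm
  | dr x => exact (ext₀_coreV hf (.inr x)).symm
  | ch j => exact ((mem_ext₀.1 hf).2.1 j).symm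
  | dh j => exact (ext₀_dh hf j).symm

/-- **`ext₀ ≃ ∏_b PM(block b)`.** [cite: Rothvoss2017, Lem. 15] -/
def extEquiv : ((b : BIdx m) → PMf (BV k b)) ≃ {f // f ∈ ext₀ k m} where
  toFun y := ⟨glue y, glue_mem_ext₀ y⟩
  invFun f := coords f.1 f.2
  left_inv y := coords_glue y
  right_inv f := Subtype.ext (glue_coords f.2)

/-- `|ext₀| = |∏_b PM(block b)|`. [cite: Rothvoss2017, Lem. 15] -/
theorem card_ext₀_eq : (ext₀ k m).card = Fintype.card ((b : BIdx m) → PMf (BV k b)) := by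
  rw [← Fintype.card_coe, Fintype.card_congr (extEquiv (k := k) (m := m)).symm]

/-- Transfer of counts along the block product: `#{f ∈ ext₀ | P f} = #{y | P (glue y)}`. [folklore] -/
theorem card_filter_ext₀ (P : (TV k m → TV k m) → Prop) [DecidablePred P] :
    ((ext₀ k m).filter P).card =
      ((univ : Finset ((b : BIdx m) → PMf (BV k b))).filter fun y => P (glue y)).card := by
  refine card_bij' (fun f hf => coords f (mem_filter.1 hf).1) (fun y _ => glue y) (fun f hf => ?_)
    (fun y hy => ?_) (fun f hf => glue_coords (mem_filter.1 hf).1) (fun y _ => coords_glue y)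
  · obtain ⟨hf, hP⟩ := mem_filter.1 hf
    simp only [mem_filter, mem_univ, true_and]
    rwa [glue_coords hf]
  · simp only [mem_filter, mem_univ, true_and] at hy
    exact mem_filter.2 ⟨glue_mem_ext₀ y, hy⟩

/-! ### Coordinate fibres of a finite product -/

/-- In a finite product `∏ᵢ Xᵢ`, every fibre of the projection to `X_{i₀}` has size
`|∏ᵢ Xᵢ| / |X_{i₀}|`. [folklore] -/
theorem card_filter_apply_eq_mul {ι : Type*} [Fintype ι] [DecidableEq ι] {X : ι → Type*}
    [∀ i, Fintype (X i)] [∀ i, DecidableEq (X i)] (i₀ : ι) (x₀ : X i₀) :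
    ((univ : Finset ((i : ι) → X i)).filter fun y => y i₀ = x₀).card * Fintype.card (X i₀) =
      Fintype.card ((i : ι) → X i) := by
  have hconst : ∀ x : X i₀, ((univ : Finset ((i : ι) → X i)).filter fun y => y i₀ = x).card =
      ((univ : Finset ((i : ι) → X i)).filter fun y => y i₀ = x₀).card := fun x => by
    refine card_bij' (fun y _ => Function.update y i₀ x₀) (fun y _ => Function.update y i₀ x)
      (fun y _ => by simp) (fun y _ => by simp) (fun y hy => ?_) (fun y hy => ?_)
    · simp only [mem_filter, mem_univ, true_and] at hy
      rw [Function.update_idem, ← hy, Function.update_eq_self]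
    · simp only [mem_filter, mem_univ, true_and] at hy
      rw [Function.update_idem, ← hy, Function.update_eq_self]
  have hsum := card_eq_sum_card_fiberwise (f := fun y : (i : ι) → X i => y i₀)
    (s := univ) (t := univ) fun _ _ => mem_univ _
  simp only [hconst, sum_const, smul_eq_mul, card_univ] at hsum
  rw [hsum, mul_comm]

/-! ### Fibres of `ext₀` over one block -/

/-- A glued matching has `Bⱼ`-component `ψ` iff its block coordinate at `Bⱼ` is `ψ`. [folklore] -/
theorem glue_b_iff (y : (b : BIdx m) → PMf (BV k b)) (j : Fin m) (ψ : PMf (Fin (2 * (k - 3)))) :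
    (∀ y', glue y (.b j y') = .b j (ψ.1 y')) ↔ y (some (.inr j)) = ψ := by
  constructor
  · intro hy
    apply Subtype.ext
    funext y'
    exact (TV.b.inj (hy y')).2
  · intro hy y'
    rw [glue_b, hy]

/-- The block types `PMf (BV k (inr j))` and `PMf (Fin (2(k-3)))` have the same size (they are the
same type). [folklore] -/
theorem card_PMf_BV_inr (j : Fin m) :
    Fintype.card (PMf (BV k (some (.inr j) : BIdx m))) = Fintype.card (PMf (Fin (2 * (k - 3)))) :=
  Fintype.card_congr (Equiv.refl _)

/-- **Every `Bⱼ`-fibre of `ext₀` has size `|ext₀| / |PM(Bⱼ)|`.** [cite: Rothvoss2017, Lem. 15] -/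
theorem card_ext₀_fibre_b (j : Fin m) (ψ : PMf (Fin (2 * (k - 3)))) :
    ((ext₀ k m).filter fun f => ∀ y, f (.b j y) = .b j (ψ.1 y)).card *
      Fintype.card (PMf (Fin (2 * (k - 3)))) = (ext₀ k m).card := by
  rw [card_filter_ext₀, card_ext₀_eq]
  have h : ((univ : Finset ((b : BIdx m) → PMf (BV k b))).filter fun y =>
      ∀ y', glue y (.b j y') = .b j (ψ.1 y')) = univ.filter fun y => y (some (.inr j)) = ψ := by
    ext y
    simp only [mem_filter, mem_univ, true_and]
    exact glue_b_iff y j ψ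
  rw [h]
  convert card_filter_apply_eq_mul (X := fun b : BIdx m => PMf (BV k b)) (some (.inr j)) ψ
    using 2
  · congr
  · exact Fintype.card_congr (Equiv.refl _)

/-- **`|matsAll₀ g| · |PM(cr ∪ dr)| = |ext₀|`** for `g ∈ coreG` (the core-remainder fibres of `ext₀`).
[cite: Rothvoss2017, Lem. 15] -/
theorem card_matsAll₀_mul {g : TV k m → TV k m} (hg : g ∈ coreG k m) :
    (matsAll₀ g).card * Fintype.card (PMf (CoreV k)) = (ext₀ k m).card := by
  unfold matsAll₀
  rw [card_filter_ext₀, card_ext₀_eq]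
  have h : ((univ : Finset ((b : BIdx m) → PMf (BV k b))).filter fun y =>
      ∀ v, (lab v).isCoreRem = true → glue y v = g v) =
      univ.filter fun y => y none = ⟨coreMap g, coreMap_spec_coreG hg⟩ := by
    ext y
    simp only [mem_filter, mem_univ, true_and]
    constructor
    · intro hy
      apply Subtype.ext
      funext c
      apply coreV_injective (m := m)
      rw [← glue_coreV, hy _ (isCoreRem_lab_coreV c), coreG_coreV hg]
    · intro hy v hv
      obtain ⟨c, rfl⟩ := exists_coreV_of_isCoreRem hv
      rw [glue_coreV, hy, coreG_coreV hg]
  rw [h]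
  convert card_filter_apply_eq_mul (X := fun b : BIdx m => PMf (BV k b)) none
    (⟨coreMap g, coreMap_spec_coreG hg⟩ : PMf (CoreV k)) using 2
  · exact congrArg _ (filter_congr fun _ _ => Iff.rfl)
  · exact Fintype.card_congr (Equiv.refl _)

/-- **`|ext₀| ≤ |PM(cr ∪ dr)| · |mats₀|`** (`k` odd): the crude comparison behind the paper's
`|Y| ≥ 2^{-δ m} ∏_{j ≠ i} |X_j| ≥ 2^{-2δ m} |X|`. [cite: Rothvoss2017, Lem. 15] -/
theorem card_ext₀_le (hk : Odd k) :
    (ext₀ k m).card ≤ Fintype.card (PMf (CoreV k)) * (mats₀ k m).card := by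
  obtain ⟨f₀, hf₀⟩ := mats₀_nonempty (m := m) hk
  have hg₀ := restrictCore_mem f₀ hf₀
  have hsub : matsAll₀ (restrictCore f₀) ⊆ mats₀ k m := fun f hf =>
    ((mem_mats₀_and_restrictCore_eq hg₀).2 hf).1
  rw [← card_matsAll₀_mul (coreGsep_subset hg₀), mul_comm]
  exact Nat.mul_le_mul_left _ (card_le_card hsub)

/-- `ext₀` is nonempty (`k` odd). [folklore] -/
theorem card_ext₀_pos (hk : Odd k) : 0 < (ext₀ k m).card :=
  card_pos.2 ⟨_, mats₀_subset_ext₀ (mats₀_nonempty (m := m) hk).choose_spec⟩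

end Rothvoss

end Literature.Computability.Complexity

/-!
# Part IV — The contribution of `M`-bad pairs (Rothvoss 2017, Lemma 15)

As for the `U`-part (`RothvossUBadPart.lean`), the paper's bound `Pr_{T ∼ 𝒫(U,M)}[M-BAD] ≤ η` is
replaced by the uniform-cover double counting `sum_bad_le_of_cover`: `pM τ` is the average over the
template matchings `f₀ ∈ mats₀` of `[τ f₀ τ⁻¹ ∈ 𝓜]`, the weight `pU τ · [τ f₀ τ⁻¹ ∈ 𝓜]` is invariant
under the big-block swaps `bigSwap j θ` with `θ` intertwining `f₀` (`swapsM f₀`; Part II), this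
family is uniform in `j` (Part I: `|swapsM f₀| = m · N(f₀)`), and for every encoding `τ` at most a
`3ε₁`-fraction of it yields an `M`-bad encoding (`card_mbad_le`) — the paper's second-phase argument:
an `M`-bad swapped encoding is not small, so `|𝓨| ≥ 2^{-δ m} |mats₀| ≥ 2^{-δ₁(2m+1)} |X|`; by the
entropy lemma (hypothesis `hL10M`, an instance of `few_biased_coordinates` on the block product of
Part III) all but `ε₁ (2m+1) ≤ 3 ε₁ m` blocks are `ε₁`-unbiased, and those give `M`-good encodings
(Corollary 11, `mgood_of_unbiased`).

Main result: `mbad_part` — `∑_τ M-BAD(τ) · pU τ · pM τ ≤ 3 ε₁ · ∑_τ pU τ · pM τ`.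

## References

* T. Rothvoss, *The matching polytope has exponential extension complexity*, J. ACM 64(6) (2017)
  41:1–41:19, §3.6.2 (Lemma 15) [Rothvoss2017].
-/

namespace Literature.Computability.Complexity

open Finset
open Literature.Probability.LatticeModels

namespace Rothvoss

open scoped Classical

variable {k m : ℕ}

/-! ### The swaps of the `M`-part -/

/-- The swaps of the `M`-part for the template matching `f₀`: a big block `j` and an identification
`θ` of the core remainder with `Bⱼ` intertwining `f₀|_{cr ∪ dr}` with `f₀|_{Bⱼ}`.
[cite: Rothvoss2017, Lem. 15] -/
def swapsM (f₀ : TV k m → TV k m) : Finset (Fin m × (CoreV k ≃ Fin (2 * (k - 3)))) :=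
  univ.filter fun p => ∀ c, p.2 (coreMap f₀ c) = bMap f₀ p.1 (p.2 c)

/-- Membership in `swapsM`. [folklore] -/
theorem mem_swapsM {f₀ : TV k m → TV k m} {p : Fin m × (CoreV k ≃ Fin (2 * (k - 3)))} :
    p ∈ swapsM f₀ ↔ ∀ c, p.2 (coreMap f₀ c) = bMap f₀ p.1 (p.2 c) := by
  simp [swapsM]

/-- The size of the centraliser of `f₀|_{cr ∪ dr}` (the common size of the fibres of `swapsM f₀`).
[folklore] -/
noncomputable def autN (f₀ : TV k m → TV k m) : ℕ :=
  ((univ : Finset (CoreV k ≃ CoreV k)).filter fun θ => ∀ c, θ (coreMap f₀ c) = coreMap f₀ (θ c)).card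

/-- `autN f₀ > 0`. [folklore] -/
theorem autN_pos (f₀ : TV k m → TV k m) : 0 < autN f₀ :=
  card_self_intertwiners_pos _

/-- **Uniformity of the cover**: the number of swaps `(j, θ) ∈ swapsM f₀` with first coordinate in a
given set `Q` is `#Q · autN f₀` (every big block admits the same number of intertwiners, Part I).
[cite: Rothvoss2017, Lem. 15] -/
theorem card_swapsM_filter_fst {f₀ : TV k m → TV k m} (hf₀ : f₀ ∈ ext₀ k m) (T : Finset (Fin m)) :
    ((swapsM f₀).filter fun p => p.1 ∈ T).card = T.card * autN f₀ := by
  rw [card_eq_sum_card_fiberwise (f := Prod.fst) (s := (swapsM f₀).filter fun p => p.1 ∈ T)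
    (t := T) (fun p hp => by
      simp only [coe_filter, Set.mem_setOf_eq] at hp
      exact hp.2)]
  have hfib : ∀ j ∈ T,
      (((swapsM f₀).filter fun p => p.1 ∈ T).filter fun p => p.1 = j).card = autN f₀ := by
    intro j hj
    rw [autN, ← card_intertwiners_eq (coreFinEquiv k) (coreMap_spec_ext₀ hf₀) (bMap_spec_ext₀ hf₀ j)]
    refine card_bij' (fun p _ => p.2) (fun θ _ => (j, θ)) (fun p hp => ?_) (fun θ hθ => ?_)
      (fun p hp => ?_) (fun θ _ => rfl)
    · simp only [mem_filter, mem_swapsM] at hp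
      obtain ⟨⟨hp, -⟩, rfl⟩ := hp
      exact mem_filter.2 ⟨mem_univ _, hp⟩
    · simp only [mem_filter, mem_univ, true_and] at hθ
      exact mem_filter.2 ⟨mem_filter.2 ⟨mem_swapsM.2 hθ, hj⟩, rfl⟩
    · simp only [mem_filter] at hp
      obtain ⟨-, rfl⟩ := hp
      rfl
  rw [sum_congr rfl hfib, sum_const, smul_eq_mul]

/-- `|swapsM f₀| = m · autN f₀`. [cite: Rothvoss2017, Lem. 15] -/
theorem card_swapsM {f₀ : TV k m → TV k m} (hf₀ : f₀ ∈ ext₀ k m) :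
    (swapsM f₀).card = m * autN f₀ := by
  have h := card_swapsM_filter_fst hf₀ univ
  rw [filter_true_of_mem (fun p _ => mem_univ _), card_univ, Fintype.card_fin] at h
  exact h

/-- `swapsM f₀` is nonempty for `m ≥ 1` (intertwiners exist, Part I). [cite: Rothvoss2017, Lem. 15] -/
theorem swapsM_nonempty (hm : 0 < m) {f₀ : TV k m → TV k m} (hf₀ : f₀ ∈ ext₀ k m) :
    (swapsM f₀).Nonempty := by
  obtain ⟨θ, hθ⟩ := exists_intertwiner (coreFinEquiv k) (coreMap_spec_ext₀ hf₀) (bMap_spec_ext₀ hf₀ ⟨0, hm⟩)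
  exact ⟨(⟨0, hm⟩, θ), mem_swapsM.2 hθ⟩

/-! ### Lemma 15: the per-encoding count -/

/-- **Lemma 15 of Rothvoss 2017 (second phase, per encoding).** Fix an encoding `τ` and a template
matching `f₀ ∈ mats₀`. Among the swaps `(j, θ) ∈ swapsM f₀` (re-choosing the core remainder among the
big blocks, compatibly with `f₀`), at most a `3ε₁`-fraction yields an `M`-bad encoding: if some swapped
encoding is `M`-bad it is not small, so `|𝓨_τ| ≥ 2^{-δ m} |mats₀| ≥ 2^{-δ₁(2m+1)} |X|`; then
(entropy lemma on the block product, hypothesis `hL10M`) all but `ε₁ (2m+1)` blocks are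
`ε₁`-unbiased, and unbiased big blocks give `M`-good encodings (`mgood_of_unbiased`).
[cite: Rothvoss2017, Lem. 15] -/
theorem card_mbad_le (hk : Odd k) (hm : 0 < m) {ε ε₁ δ δ₁ : ℝ} (hε₁ : 0 ≤ ε₁) (hε : ε₁ ≤ ε)
    (hL10M : ∀ Y : Finset ((b : BIdx m) → PMf (BV k b)),
      (2 : ℝ) ^ (-(δ₁ * (2 * (m : ℝ) + 1))) * Fintype.card ((b : BIdx m) → PMf (BV k b)) ≤ Y.card →
      ∃ B : Finset (BIdx m), (B.card : ℝ) ≤ ε₁ * (2 * (m : ℝ) + 1) ∧ ∀ b ∉ B, ∀ x : PMf (BV k b),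
        (Y.card : ℝ) / ((1 + ε₁) * Fintype.card (PMf (BV k b))) ≤ (Y.filter fun y => y b = x).card ∧
        ((Y.filter fun y => y b = x).card : ℝ) ≤ (1 + ε₁) * Y.card / Fintype.card (PMf (BV k b)))
    (hdensM : (2 : ℝ) ^ (-(δ₁ * (2 * (m : ℝ) + 1))) * (ext₀ k m).card ≤
      (2 : ℝ) ^ (-(δ * (m : ℝ))) * (mats₀ k m).card)
    (𝓤 : Finset (Finset (Fin (rvN k m)))) (𝓜 : Finset ((⊤ : SimpleGraph (Fin (rvN k m))).Subgraph))
    (τ : Bij k m) {f₀ : TV k m → TV k m} (hf₀ : f₀ ∈ mats₀ k m) :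
    (((swapsM f₀).filter fun p => MBad k m 𝓤 𝓜 ε δ ((bigSwap p.1 p.2).trans τ)).card : ℝ) ≤
      3 * ε₁ * (swapsM f₀).card := by
  have hf₀e : f₀ ∈ ext₀ k m := mats₀_subset_ext₀ hf₀
  rcases ((swapsM f₀).filter fun p =>
      MBad k m 𝓤 𝓜 ε δ ((bigSwap p.1 p.2).trans τ)).eq_empty_or_nonempty with hS | ⟨p₀, hp₀⟩
  · rw [hS, card_empty, Nat.cast_zero]
    positivity
  -- a bad swap gives a non-small encoding, hence a dense `𝓨`
  have hbad₀ := (mem_filter.1 hp₀).2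
  unfold MBad at hbad₀
  have hns := hbad₀.1
  unfold Small at hns
  push Not at hns
  have hmats : (0 : ℝ) < (mats₀ k m).card := by exact_mod_cast (mats₀_nonempty hk).card_pos
  have hE : (0 : ℝ) < (ext₀ k m).card := by exact_mod_cast card_ext₀_pos hk
  -- `Yc = |𝓨_τ|`
  have hYc_ge : (2 : ℝ) ^ (-(δ * (m : ℝ))) * (mats₀ k m).card <
      ((ext₀ k m).filter fun f => toSub τ f ∈ 𝓜).card := by
    have hpM := hns.1
    unfold pM at hpM
    rw [lt_div_iff₀ hmats] at hpM
    refine hpM.trans_le ?_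
    rw [← card_ext₀_filter_bigSwap 𝓜 p₀.1 p₀.2 τ]
    exact_mod_cast card_le_card (filter_subset_filter _ mats₀_subset_ext₀)
  have hYpos : (0 : ℝ) < ((ext₀ k m).filter fun f => toSub τ f ∈ 𝓜).card :=
    lt_of_le_of_lt (by positivity) hYc_ge
  have hpos : 0 < pH k m 𝓜 τ := by
    unfold pH
    positivity
  -- the block-product picture
  have hYc : (((univ : Finset ((b : BIdx m) → PMf (BV k b))).filter fun y =>
      toSub τ (glue y) ∈ 𝓜).card : ℝ) = ((ext₀ k m).filter fun f => toSub τ f ∈ 𝓜).card := by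
    exact_mod_cast (card_filter_ext₀ (fun f => toSub τ f ∈ 𝓜)).symm
  obtain ⟨B, hBcard, hB⟩ := hL10M (univ.filter fun y => toSub τ (glue y) ∈ 𝓜) (by
    rw [hYc, ← card_ext₀_eq]
    exact hdensM.trans hYc_ge.le)
  -- every bad swap has its big block in `B`
  have hq : 0 < Fintype.card (PMf (Fin (2 * (k - 3)))) :=
    Fintype.card_pos_iff.2 ⟨⟨bMap f₀ p₀.1, bMap_spec_ext₀ hf₀e p₀.1⟩⟩
  have hsub : ((swapsM f₀).filter fun p => MBad k m 𝓤 𝓜 ε δ ((bigSwap p.1 p.2).trans τ)) ⊆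
      (swapsM f₀).filter fun p => p.1 ∈ univ.filter fun j => (some (.inr j) : BIdx m) ∈ B := by
    intro p hp
    obtain ⟨hpS, hbad⟩ := mem_filter.1 hp
    unfold MBad at hbad
    refine mem_filter.2 ⟨hpS, mem_filter.2 ⟨mem_univ _, ?_⟩⟩
    by_contra hjB
    refine hbad.2 (mgood_of_unbiased hε₁ hε p.1 p.2 hq hpos
      (fun ψ hψ => card_ext₀_fibre_b p.1 ⟨ψ, hψ⟩) (fun ψ hψ => ?_))
    have h := hB _ hjB ⟨ψ, hψ⟩
    rw [card_PMf_BV_inr, hYc] at h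
    have hfib : (((univ : Finset ((b : BIdx m) → PMf (BV k b))).filter fun y =>
        toSub τ (glue y) ∈ 𝓜).filter fun y => y (some (.inr p.1)) = ⟨ψ, hψ⟩).card =
        ((ext₀ k m).filter fun f => (∀ y, f (.b p.1 y) = .b p.1 (ψ y)) ∧ toSub τ f ∈ 𝓜).card := by
      rw [card_filter_ext₀, filter_filter]
      congr 1
      ext y
      simp only [mem_filter, mem_univ, true_and]
      rw [glue_b_iff y p.1 ⟨ψ, hψ⟩]
      tauto
    rw [hfib] at h
    exact h
  -- counting
  have hinj : ((univ : Finset (Fin m)).filter fun j => (some (.inr j) : BIdx m) ∈ B).card ≤ B.card :=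
    card_le_card_of_injOn (fun j => (some (.inr j) : BIdx m)) (fun j hj => by simpa using hj)
      (fun j₁ _ j₂ _ h => by simpa using h)
  have hcount : (((swapsM f₀).filter fun p =>
      p.1 ∈ univ.filter fun j => (some (.inr j) : BIdx m) ∈ B).card : ℝ) ≤ B.card * autN f₀ := by
    rw [card_swapsM_filter_fst hf₀e, Nat.cast_mul]
    gcongr
  have hN : (0 : ℝ) ≤ autN f₀ := Nat.cast_nonneg _
  have hm1 : (2 * (m : ℝ) + 1) ≤ 3 * m := by
    have : (1 : ℝ) ≤ m := by exact_mod_cast hm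
    linarith
  calc (((swapsM f₀).filter fun p => MBad k m 𝓤 𝓜 ε δ ((bigSwap p.1 p.2).trans τ)).card : ℝ)
      ≤ ((swapsM f₀).filter fun p =>
          p.1 ∈ univ.filter fun j => (some (.inr j) : BIdx m) ∈ B).card := by
        exact_mod_cast card_le_card hsub
    _ ≤ B.card * autN f₀ := hcount
    _ ≤ ε₁ * (2 * (m : ℝ) + 1) * autN f₀ := by gcongr
    _ ≤ ε₁ * (3 * m) * autN f₀ := by gcongr
    _ = 3 * ε₁ * (swapsM f₀).card := by
        rw [card_swapsM hf₀e, Nat.cast_mul]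
        ring

/-! ### Lemma 15: summation over encodings -/

section Defs

variable (k m)
variable (𝓤 : Finset (Finset (Fin (rvN k m))))
  (𝓜 : Finset ((⊤ : SimpleGraph (Fin (rvN k m))).Subgraph))

/-- The weight `p^ex_{U,T}(H) · [τ f₀ τ⁻¹ ∈ 𝓜]` of an encoding, for a fixed template matching `f₀`
(so that `pU τ · pM τ` is the average of these weights over `f₀ ∈ mats₀`). [cite: Rothvoss2017, §3.6] -/
noncomputable def wM (f₀ : TV k m → TV k m) (τ : Bij k m) : ℝ :=
  pU k m 𝓤 τ * (if toSub τ f₀ ∈ 𝓜 then 1 else 0)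

end Defs

/-- `pU τ · pM τ` is the average over `f₀ ∈ mats₀` of the weights `wM f₀ τ`. [cite: Rothvoss2017, §3.6] -/
theorem pU_mul_pM_eq_sum_wM (𝓤 : Finset (Finset (Fin (rvN k m))))
    (𝓜 : Finset ((⊤ : SimpleGraph (Fin (rvN k m))).Subgraph)) (τ : Bij k m) :
    pU k m 𝓤 τ * pM k m 𝓜 τ = (∑ f₀ ∈ mats₀ k m, wM k m 𝓤 𝓜 f₀ τ) / (mats₀ k m).card := by
  unfold pM wM
  rw [natCast_card_filter, ← mul_sum, mul_div_assoc]

/-- The weight `wM f₀` is invariant under the swaps of `swapsM f₀` (`pU` is unchanged, `pU_bigSwap`,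
and `f₀` is fixed by an intertwined swap, `conj_bigSwap_eq_self`). [cite: Rothvoss2017, Lem. 15] -/
theorem wM_bigSwap (𝓤 : Finset (Finset (Fin (rvN k m))))
    (𝓜 : Finset ((⊤ : SimpleGraph (Fin (rvN k m))).Subgraph)) {f₀ : TV k m → TV k m}
    (hf₀ : f₀ ∈ ext₀ k m) {p : Fin m × (CoreV k ≃ Fin (2 * (k - 3)))} (hp : p ∈ swapsM f₀)
    (τ : Bij k m) : wM k m 𝓤 𝓜 f₀ ((bigSwap p.1 p.2).trans τ) = wM k m 𝓤 𝓜 f₀ τ := by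
  unfold wM
  rw [pU_bigSwap, toSub_trans _ _ (mem_ext₀.1 hf₀).1, conj_bigSwap_eq_self hf₀ (mem_swapsM.1 hp)]

/-- **Summation of Lemma 15 over encodings**: a per-encoding bound "at most an `η`-fraction of the
swaps in `swapsM f₀` give an `M`-bad encoding" yields `∑_τ M-BAD(τ) pU τ pM τ ≤ η ∑_τ pU τ pM τ`.
[cite: Rothvoss2017, §3.6 & Lem. 15] -/
theorem sum_mbad_le (hk : Odd k) (hm : 0 < m) {ε δ η : ℝ} (𝓤 : Finset (Finset (Fin (rvN k m))))
    (𝓜 : Finset ((⊤ : SimpleGraph (Fin (rvN k m))).Subgraph))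
    (hper : ∀ (τ : Bij k m) (f₀ : TV k m → TV k m), f₀ ∈ mats₀ k m →
      (((swapsM f₀).filter fun p => MBad k m 𝓤 𝓜 ε δ ((bigSwap p.1 p.2).trans τ)).card : ℝ) ≤
        η * (swapsM f₀).card) :
    ∑ τ, (if MBad k m 𝓤 𝓜 ε δ τ then pU k m 𝓤 τ * pM k m 𝓜 τ else 0) ≤
      η * ∑ τ, pU k m 𝓤 τ * pM k m 𝓜 τ := by
  have hc : (0 : ℝ) < (mats₀ k m).card := by exact_mod_cast (mats₀_nonempty hk).card_pos
  have hw : ∀ f₀ ∈ mats₀ k m,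
      ∑ τ, (if MBad k m 𝓤 𝓜 ε δ τ then wM k m 𝓤 𝓜 f₀ τ else 0) ≤ η * ∑ τ, wM k m 𝓤 𝓜 f₀ τ := by
    intro f₀ hf₀
    have hf₀e := mats₀_subset_ext₀ hf₀
    refine sum_bad_le_of_cover (swapsM f₀) (swapsM_nonempty hm hf₀e) (fun p => bigSwap p.1 p.2)
      (wM k m 𝓤 𝓜 f₀) (fun τ => ?_) (fun p hp τ => wM_bigSwap 𝓤 𝓜 hf₀e hp τ) _
      (fun τ => hper τ f₀ hf₀)
    unfold wM
    exact mul_nonneg (pU_mem τ).1 (by split_ifs <;> norm_num)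
  calc ∑ τ, (if MBad k m 𝓤 𝓜 ε δ τ then pU k m 𝓤 τ * pM k m 𝓜 τ else 0)
      = ∑ τ, (∑ f₀ ∈ mats₀ k m, if MBad k m 𝓤 𝓜 ε δ τ then wM k m 𝓤 𝓜 f₀ τ else 0) /
          (mats₀ k m).card := by
        refine sum_congr rfl fun τ _ => ?_
        split_ifs with h
        · rw [pU_mul_pM_eq_sum_wM]
        · simp
    _ = (∑ f₀ ∈ mats₀ k m, ∑ τ, if MBad k m 𝓤 𝓜 ε δ τ then wM k m 𝓤 𝓜 f₀ τ else 0) /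
          (mats₀ k m).card := by
        rw [← sum_div, sum_comm]
    _ ≤ (∑ f₀ ∈ mats₀ k m, η * ∑ τ, wM k m 𝓤 𝓜 f₀ τ) / (mats₀ k m).card := by
        gcongr with f₀ hf₀
        exact hw f₀ hf₀
    _ = η * ∑ τ, pU k m 𝓤 τ * pM k m 𝓜 τ := by
        rw [← mul_sum, sum_comm, mul_div_assoc, sum_div]
        simp only [pU_mul_pM_eq_sum_wM]

/-- **The `M`-bad part of Lemma 7 (Lemma 15 of Rothvoss 2017, summed form)**:
`∑_τ M-BAD(τ) · pU τ · pM τ ≤ 3ε₁ · ∑_τ pU τ · pM τ`, for `ε₁ ≤ ε`, the entropy lemma on the block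
product with parameters `(ε₁, δ₁)` (hypothesis `hL10M`, an instance of `few_biased_coordinates`), and
`m ≥ 1` with `2^{-δ₁(2m+1)} |ext₀| ≤ 2^{-δ m} |mats₀|`. [cite: Rothvoss2017, Lem. 15] -/
theorem mbad_part (hk : Odd k) (hm : 0 < m) {ε ε₁ δ δ₁ : ℝ} (hε₁ : 0 ≤ ε₁) (hε : ε₁ ≤ ε)
    (hL10M : ∀ Y : Finset ((b : BIdx m) → PMf (BV k b)),
      (2 : ℝ) ^ (-(δ₁ * (2 * (m : ℝ) + 1))) * Fintype.card ((b : BIdx m) → PMf (BV k b)) ≤ Y.card →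
      ∃ B : Finset (BIdx m), (B.card : ℝ) ≤ ε₁ * (2 * (m : ℝ) + 1) ∧ ∀ b ∉ B, ∀ x : PMf (BV k b),
        (Y.card : ℝ) / ((1 + ε₁) * Fintype.card (PMf (BV k b))) ≤ (Y.filter fun y => y b = x).card ∧
        ((Y.filter fun y => y b = x).card : ℝ) ≤ (1 + ε₁) * Y.card / Fintype.card (PMf (BV k b)))
    (hdensM : (2 : ℝ) ^ (-(δ₁ * (2 * (m : ℝ) + 1))) * (ext₀ k m).card ≤
      (2 : ℝ) ^ (-(δ * (m : ℝ))) * (mats₀ k m).card)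
    (𝓤 : Finset (Finset (Fin (rvN k m)))) (𝓜 : Finset ((⊤ : SimpleGraph (Fin (rvN k m))).Subgraph)) :
    ∑ τ, (if MBad k m 𝓤 𝓜 ε δ τ then pU k m 𝓤 τ * pM k m 𝓜 τ else 0) ≤
      3 * ε₁ * ∑ τ, pU k m 𝓤 τ * pM k m 𝓜 τ :=
  sum_mbad_le hk hm 𝓤 𝓜 fun τ _ hf₀ => card_mbad_le hk hm hε₁ hε hL10M hdensM 𝓤 𝓜 τ hf₀

end Rothvoss

end Literature.Computability.Complexity
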